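import Literature.Analysis.ValidatedNumerics.ParametricEigenMargin
import Literature.Analysis.ValidatedNumerics.SymInertiaCertificate
import HarnessLib

/-!
# Kernel-checkable VERTEX BUNDLES: the eigenvalue margin of an affine symmetric family over a box,
# decided end-to-end from `2^K` exact vertex certificates (Hladík 2017 Thm 7 + `checkLower`)

Topic `Literature/Analysis/ValidatedNumerics`. The CHECKER layer that closes the VERTEX method of the
eigenvalue-margin call as ONE kernel theorem per family (design note
`run/shared/lean/pub/certnum/sdp/DESIGN-eigopt.md` §2 M1, §9 G1 «with G1 the vertex bundle closes as ONE
kernel theorem per family»). Data: an affine family `A(p) = A₀ + Σ_{k<K} p_k A^{(k)}` of rational `n × n`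
tables, a rational box `[lo_k, hi_k]`, a claimed margin `lam` and one `LDLCert` (format of
`SymmetricEigenCertificate.checkLower`) per box CORNER, listed in the order of `corners lo hi K`.
The Boolean checker `checkVertexBundle` (i) checks every table symmetric, (ii) enumerates the `2^K`
corners, forms each corner matrix `A(v)` in exact rational arithmetic, and (iii) runs `checkLower`
with zero radii and claim `≥ lam` at every corner. SOUNDNESS
(`le_eigenvalues_affine_of_checkVertexBundle`): for EVERY real parameter `p` of the box and every index
`i`, `lam ≤ λᵢ(A(p))` — the corner facts (`MatrixEigenEnclosure.mul_dotProduct_le_of_checkLower`) are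
carried to the box by `ParametricEigenMargin.mul_dotProduct_affine_ge_of_forall_vertex` (Hladík's
sign-vertex argument: `λ_min` of an affine family is concave in `p`). Also the form version and positive
definiteness on the box. A closing `example` evaluates the checker in the kernel (`K = 1`, `n = 2`).

This replaces «`2^K` separate `checkLower` theorems + the vertex theorem cited in prose» by a single
`decide`-able statement; it is what an emitted vertex-bundle source proves. Nothing here is new
mathematics.

## What is NOT certified

Non-affine dependence on `p` (no vertex shortcut — use the kd scan `ParametricEigenScan.lean`);
interior eigenvalues; anything off the box or about an operator the family discretises; the float
computation that proposed the certificates.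

## References

* [Hladik2017] M. Hladík, arXiv:1704.05782 (2017), Thm. 7 (vertices decide positive definiteness of a
  linear parametric family) — margin / constant-term corollary as in `ParametricEigenMargin.lean`.
-/

open Finset Matrix

namespace Literature.Analysis.ValidatedNumerics

open ParametricIntervalPosSemidef ParametricEigenMargin

/-! ### Data and checker -/

/-- All corner lists of the box `[lo_k, hi_k]`, `k < K`: every list `v` of length `K` with
`v_k ∈ {lo_k, hi_k}` (`2^K` of them, duplicates when `lo_k = hi_k`). [cite: Hladik2017, Thm. 3 (2)] -/
def corners (lo hi : List ℚ) : ℕ → List (List ℚ)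
  | 0 => [[]]
  | K + 1 => (corners lo hi K).flatMap fun t ↦ [t ++ [vget lo K], t ++ [vget hi K]]

/-- The corner matrix `A(v) = A₀ + Σ_{k<K} v_k A^{(k)}` as a rational table. [cite: Hladik2017, §2] -/
def affineAtQ (n K : ℕ) (A0 : List (List ℚ)) (As : List (List (List ℚ))) (v : List ℚ) :
    List (List ℚ) :=
  mtab n n fun i j ↦ mget A0 i j + rsum K fun k ↦ vget v k * mget (As.getD k []) i j

/-- The zero radius table. [folklore] -/
def zeroTab (n : ℕ) : List (List ℚ) := mtab n n fun _ _ ↦ 0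

/-- Symmetry of a rational table on the `n × n` block. [folklore] -/
def symmQ (n : ℕ) (A : List (List ℚ)) : Bool :=
  rall n fun i ↦ rall n fun j ↦ decide (mget A i j = mget A j i)

/-- A vertex bundle: the claimed margin `lam` and one lower certificate per corner (order of
`corners lo hi K`). [cite: Hladik2017, Thm. 7] -/
structure VertexBundle where
  /-- the claimed margin: `lam ≤ λ_min(A(p))` on the box -/
  lam : ℚ
  /-- one `LDLCert` per corner, in the order of `corners lo hi K` -/
  certs : List LDLCert
  deriving Inhabited

/-- **The vertex-bundle checker**: all tables symmetric; at least `2^K` certificates; at every corner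
`v` the certificate claims `≥ lam` and passes `checkLower` on the exact corner matrix with zero radii.
[cite: Hladik2017, Thm. 7 ((2) ⇒ (1))] -/
def checkVertexBundle (n K : ℕ) (A0 : List (List ℚ)) (As : List (List (List ℚ))) (lo hi : List ℚ)
    (b : VertexBundle) : Bool :=
  symmQ n A0 && rall K (fun k ↦ symmQ n (As.getD k [])) &&
    decide ((corners lo hi K).length ≤ b.certs.length) &&
    rall (corners lo hi K).length fun idx ↦
      decide (b.lam ≤ (b.certs.getD idx default).lam) &&
        checkLower n (affineAtQ n K A0 As ((corners lo hi K).getD idx [])) (zeroTab n)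
          (b.certs.getD idx default)

/-! ### Soundness -/

/-- Entries of `finMat` (plumbing). [folklore] -/
private theorem finMat_apply' (n : ℕ) (A : List (List ℚ)) (i j : Fin n) :
    finMat n A i j = mreal A i j := rfl

/-- A symmetric table is a symmetric real matrix. [folklore] -/
private theorem isHermitian_finMat_of_symmQ {n : ℕ} {A : List (List ℚ)} (h : symmQ n A = true) :
    (finMat n A).IsHermitian := by
  refine Matrix.IsHermitian.ext fun i j ↦ ?_
  have h1 := of_rall (of_rall h j.isLt) i.isLt
  rw [decide_eq_true_eq] at h1
  rw [star_trivial, finMat_apply', finMat_apply']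
  unfold mreal; rw [h1]

/-- Every real corner of the box is (the cast of) a member of `corners lo hi K`. [folklore] -/
private theorem exists_mem_corners (lo hi : List ℚ) :
    ∀ (K : ℕ) (q : ℕ → ℝ), (∀ k < K, q k = vreal lo k ∨ q k = vreal hi k) →
      ∃ v ∈ corners lo hi K, v.length = K ∧ ∀ k < K, vreal v k = q k
  | 0, q, _ => ⟨[], by simp [corners], rfl, fun k hk ↦ absurd hk (Nat.not_lt_zero k)⟩
  | K + 1, q, hq => by
    obtain ⟨t, ht, hlen, htq⟩ := exists_mem_corners lo hi K q fun k hk ↦ hq k (Nat.lt_succ_of_lt hk)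
    -- choose the last coordinate
    have hK := hq K K.lt_succ_self
    let a : ℚ := if q K = vreal lo K then vget lo K else vget hi K
    have ha : vreal [a] 0 = q K := by
      show (((vget [a] 0 : ℚ)) : ℝ) = q K
      rw [vget_cons_zero]
      by_cases h : q K = vreal lo K
      · simp only [a, h, ↓reduceIte]; rfl
      · simp only [a, h, ↓reduceIte]
        rcases hK with h' | h'
        · exact absurd h' h
        · exact h'.symm
    refine ⟨t ++ [a], ?_, by simp [hlen], fun k hk ↦ ?_⟩
    · simp only [corners, List.mem_flatMap, List.mem_cons, List.mem_nil_iff, or_false]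
      refine ⟨t, ht, ?_⟩
      by_cases h : q K = vreal lo K
      · left; simp [a, h]
      · right; simp [a, h]
    · rcases Nat.lt_succ_iff_lt_or_eq.1 hk with hk' | hkK
      · have : vget (t ++ [a]) k = vget t k := by
          unfold vget; exact List.getD_append _ _ _ _ (hlen ▸ hk')
        unfold vreal; rw [this]; exact htq k hk'
      · have : vget (t ++ [a]) k = vget [a] 0 := by
          unfold vget; rw [hkK, List.getD_append_right _ _ _ _ (hlen ▸ le_rfl), hlen, Nat.sub_self]
        unfold vreal at ha ⊢; rw [this, hkK]; exact ha

/-- The real affine family at a cast corner equals (the cast of) the exact corner table. [folklore] -/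
private theorem affine_apply_eq_mreal_affineAtQ {n K : ℕ} (A0 : List (List ℚ))
    (As : List (List (List ℚ))) {q : Fin K → ℝ} {v : List ℚ} (hv : ∀ k : Fin K, vreal v k = q k)
    (i j : Fin n) :
    (finMat n A0 + paramMatrix (fun k : Fin K ↦ finMat n (As.getD k [])) q) i j
      = mreal (affineAtQ n K A0 As v) i j := by
  rw [Matrix.add_apply, paramMatrix_apply, finMat_apply']
  unfold affineAtQ mreal
  rw [mget_mtab _ i.isLt j.isLt, rsum_eq_sum]
  push_cast
  rw [← Fin.sum_univ_eq_sum_range (fun k ↦ ((vget v k : ℚ) : ℝ) * ((mget (As.getD k []) i j : ℚ) : ℝ)) K]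
  congr 1
  refine Finset.sum_congr rfl fun k _ ↦ ?_
  rw [finMat_apply']; unfold mreal
  rw [← hv k]; rfl

/-- **Form bound at a vertex from the bundle.** If `checkVertexBundle … = true`, then at every real
CORNER `q` of the box `lam · xᵀx ≤ xᵀA(q)x`. [cite: Hladik2017, Thm. 7 (the vertex facts)] -/
theorem form_ge_at_vertex_of_checkVertexBundle {n K : ℕ} {A0 : List (List ℚ)}
    {As : List (List (List ℚ))} {lo hi : List ℚ} {b : VertexBundle}
    (h : checkVertexBundle n K A0 As lo hi b = true) {q : Fin K → ℝ}
    (hq : IsBoxVertex (fun k : Fin K ↦ vreal lo k) (fun k : Fin K ↦ vreal hi k) q) (x : Fin n → ℝ) :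
    (b.lam : ℝ) * (x ⬝ᵥ x)
      ≤ x ⬝ᵥ (finMat n A0 + paramMatrix (fun k : Fin K ↦ finMat n (As.getD k [])) q) *ᵥ x := by
  unfold checkVertexBundle at h
  simp only [Bool.and_eq_true, decide_eq_true_eq] at h
  obtain ⟨⟨⟨-, -⟩, hlen⟩, hall⟩ := h
  -- the corner as an `ℕ`-indexed function and its rational representative
  let qN : ℕ → ℝ := fun k ↦ if hk : k < K then q ⟨k, hk⟩ else 0
  have hqN : ∀ k < K, qN k = vreal lo k ∨ qN k = vreal hi k := fun k hk ↦ by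
    simp only [qN, hk, ↓reduceDIte]; exact hq ⟨k, hk⟩
  obtain ⟨v, hvmem, -, hvq⟩ := exists_mem_corners lo hi K qN hqN
  have hv : ∀ k : Fin K, vreal v k = q k := fun k ↦ by
    rw [hvq k k.isLt]; simp only [qN, k.isLt, ↓reduceDIte]
  obtain ⟨idx, hidx, hget⟩ := List.getElem_of_mem hvmem
  have hgetD : (corners lo hi K).getD idx [] = v := by
    rw [List.getD_eq_getElem (l := corners lo hi K) (d := []) hidx, hget]
  have h1 := of_rall hall hidx
  rw [Bool.and_eq_true, decide_eq_true_eq, hgetD] at h1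
  obtain ⟨hlam, hcheck⟩ := h1
  -- the corner certificate applies to A(q) with zero radii
  have hΔ : ∀ i j : Fin n, |(finMat n A0 + paramMatrix (fun k : Fin K ↦ finMat n (As.getD k [])) q) i j
      - mreal (affineAtQ n K A0 As v) i j| ≤ mreal (zeroTab n) i j := fun i j ↦ by
    rw [affine_apply_eq_mreal_affineAtQ A0 As hv, sub_self, abs_zero]
    unfold zeroTab mreal; rw [mget_mtab _ i.isLt j.isLt]; simp
  have h2 := mul_dotProduct_le_of_checkLower hcheck hΔ x
  have hxx : 0 ≤ x ⬝ᵥ x := Finset.sum_nonneg fun i _ ↦ mul_self_nonneg (x i)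
  have h3 : (b.lam : ℝ) * (x ⬝ᵥ x) ≤ ((b.certs.getD idx default).lam : ℝ) * (x ⬝ᵥ x) :=
    mul_le_mul_of_nonneg_right (by exact_mod_cast hlam) hxx
  exact h3.trans h2

/-- `A₀` is symmetric when the bundle checks (the family's tables are «fixed symmetric matrices»).
[cite: Hladik2017, §2 (definition of `A(p)`, symmetric `A^{(k)}`)] -/
theorem isHermitian_A0_of_checkVertexBundle {n K : ℕ} {A0 : List (List ℚ)}
    {As : List (List (List ℚ))} {lo hi : List ℚ} {b : VertexBundle}
    (h : checkVertexBundle n K A0 As lo hi b = true) : (finMat n A0).IsHermitian := by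
  unfold checkVertexBundle at h
  simp only [Bool.and_eq_true, decide_eq_true_eq] at h
  exact isHermitian_finMat_of_symmQ h.1.1.1

/-- Every `A^{(k)}` is symmetric when the bundle checks. [cite: Hladik2017, §2 (definition of `A(p)`, symmetric `A^{(k)}`)] -/
theorem isHermitian_As_of_checkVertexBundle {n K : ℕ} {A0 : List (List ℚ)}
    {As : List (List (List ℚ))} {lo hi : List ℚ} {b : VertexBundle}
    (h : checkVertexBundle n K A0 As lo hi b = true) (k : Fin K) :
    (finMat n (As.getD k [])).IsHermitian := by
  unfold checkVertexBundle at h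
  simp only [Bool.and_eq_true, decide_eq_true_eq] at h
  exact isHermitian_finMat_of_symmQ (of_rall h.1.1.2 k.isLt)

/-- **Form margin on the whole box from the bundle**: `lam · xᵀx ≤ xᵀA(p)x` for every `p` of the
box (the corner facts carried to the box by Hladík's sign-vertex argument).
[cite: Hladik2017, Thm. 7 ((2) ⇒ (1)), margin form] -/
theorem form_ge_on_box_of_checkVertexBundle {n K : ℕ} {A0 : List (List ℚ)}
    {As : List (List (List ℚ))} {lo hi : List ℚ} {b : VertexBundle}
    (h : checkVertexBundle n K A0 As lo hi b = true) {p : Fin K → ℝ}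
    (hp : p ∈ Set.Icc (fun k : Fin K ↦ vreal lo k) (fun k : Fin K ↦ vreal hi k)) (x : Fin n → ℝ) :
    (b.lam : ℝ) * (x ⬝ᵥ x)
      ≤ x ⬝ᵥ (finMat n A0 + paramMatrix (fun k : Fin K ↦ finMat n (As.getD k [])) p) *ᵥ x :=
  mul_dotProduct_affine_ge_of_forall_vertex _ _
    (fun _ hq y ↦ form_ge_at_vertex_of_checkVertexBundle h hq y) hp x

/-- **Eigenvalue margin on the whole box from a kernel-checked vertex bundle (END-TO-END).** If
`checkVertexBundle n K A0 As lo hi b = true` then for every real parameter `p` with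
`lo_k ≤ p_k ≤ hi_k` and every index `i`: `b.lam ≤ λᵢ(A₀ + Σ_k p_k A^{(k)})`.
[cite: Hladik2017, Thm. 7 ((2) ⇒ (1)), margin form] -/
theorem le_eigenvalues_affine_of_checkVertexBundle {n K : ℕ} {A0 : List (List ℚ)}
    {As : List (List (List ℚ))} {lo hi : List ℚ} {b : VertexBundle}
    (h : checkVertexBundle n K A0 As lo hi b = true) {p : Fin K → ℝ}
    (hp : p ∈ Set.Icc (fun k : Fin K ↦ vreal lo k) (fun k : Fin K ↦ vreal hi k)) (i : Fin n) :
    (b.lam : ℝ) ≤ (isHermitian_affine (isHermitian_A0_of_checkVertexBundle h)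
      (isHermitian_As_of_checkVertexBundle h) p).eigenvalues i :=
  le_eigenvalues_of_forall_form_real _ (fun x ↦ form_ge_on_box_of_checkVertexBundle h hp x) i

/-- **Positive definiteness on the whole box** from a vertex bundle with `lam > 0`.
[cite: Hladik2017, Thm. 7 ((2) ⇒ (1))] -/
theorem posDef_affine_of_checkVertexBundle {n K : ℕ} {A0 : List (List ℚ)}
    {As : List (List (List ℚ))} {lo hi : List ℚ} {b : VertexBundle}
    (h : checkVertexBundle n K A0 As lo hi b = true) (hlam : 0 < b.lam) {p : Fin K → ℝ}
    (hp : p ∈ Set.Icc (fun k : Fin K ↦ vreal lo k) (fun k : Fin K ↦ vreal hi k)) :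
    (finMat n A0 + paramMatrix (fun k : Fin K ↦ finMat n (As.getD k [])) p).PosDef :=
  (isHermitian_affine (isHermitian_A0_of_checkVertexBundle h) (isHermitian_As_of_checkVertexBundle h)
      p).posDef_iff_eigenvalues_pos.2 fun i ↦
    lt_of_lt_of_le (by exact_mod_cast hlam) (le_eigenvalues_affine_of_checkVertexBundle h hp i)

/-! ### Kernel example -/

/-- `A(p) = [[2, p], [p, 2]]` on `p ∈ [−1, 1]` (eigenvalues `2 ± p ≥ 1`): the two corner matrices
`[[2, ∓1], [∓1, 2]]` pass the Gershgorin form of `checkLower` with `lam = 1` (`k = 0` factors), so the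
bundle certifies `λᵢ(A(p)) ≥ 1` on the whole box — checked by the kernel. -/
example : checkVertexBundle 2 1 [[2, 0], [0, 2]] [[[0, 1], [1, 0]]] [-1] [1]
    ⟨1, [⟨1, 0, [], []⟩, ⟨1, 0, [], []⟩]⟩ = true := by
  decide +kernel

/-! ### Pencil bundles (S4): `m · xᵀK(p)x ≤ xᵀW(p)x` and `K(p) ≻ 0` on the box from ONE check

Appended 2026-08-26 (design note §1 S4, gridfusion F3.h «discrete δW margin λ₁(W_h, K_h) ≥ m»): for two
affine families `W(p) = W₀ + Σ p_k W^{(k)}`, `K(p) = K₀ + Σ p_k K^{(k)}` (rational tables), a FIXED margin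
`m` and a definiteness margin `κ > 0`, the checker runs `checkVertexBundle` twice — on the exact tables of
the affine family `W − m·K` with claim `≥ 0`, and on `K` with claim `≥ κ` — and soundness gives, for every
`p` of the box: the energy form `m · xᵀK(p)x ≤ xᵀW(p)x` (all `x`), `xᵀK(p)x > 0` and the generalised
Rayleigh-quotient bound `m ≤ xᵀW(p)x / xᵀK(p)x` (`x ≠ 0`), i.e. every generalised eigenvalue of
`(W(p), K(p))` is `≥ m` (`ParametricEigenMargin.le_pencil_rayleigh_affine_of_forall_vertex` is the same
statement from abstract vertex hypotheses; here they are discharged by the kernel). -/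

/-- The table `A − m·B` (entrywise, exact). [folklore] -/
def subSmulTab (n : ℕ) (m : ℚ) (A B : List (List ℚ)) : List (List ℚ) :=
  mtab n n fun i j ↦ mget A i j - m * mget B i j

/-- The tables of the shifted pencil family `W − m·K`: constant part and the `K` parameter parts.
[cite: Hladik2017, §2 (definition of `A(p)`), applied to `W − mK`] -/
def pencilTabs (n K : ℕ) (m : ℚ) (W0 : List (List ℚ)) (Ws : List (List (List ℚ)))
    (K0 : List (List ℚ)) (Ks : List (List (List ℚ))) : List (List ℚ) × List (List (List ℚ)) :=
  (subSmulTab n m W0 K0, vtab K fun k ↦ subSmulTab n m (Ws.getD k []) (Ks.getD k []))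

/-- A pencil bundle: margin `m`, definiteness margin `κ` of `K`, one certificate per corner for
`W(v) − m·K(v) ⪰ 0` and one per corner for `K(v) ⪰ κ·1` (order of `corners lo hi K`).
[cite: Hladik2017, Thm. 7, applied to `W − mK` and to `K`] -/
structure PencilBundle where
  /-- the margin: `m · xᵀK(p)x ≤ xᵀW(p)x` on the box -/
  m : ℚ
  /-- definiteness margin of `K` on the box (must be `> 0`) -/
  κ : ℚ
  /-- per corner: `LDLCert` for `W(v) − m·K(v)` with claim `≥ 0` -/
  certsW : List LDLCert
  /-- per corner: `LDLCert` for `K(v)` with claim `≥ κ` -/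
  certsK : List LDLCert
  deriving Inhabited

/-- **The pencil-bundle checker**: `κ > 0`, the vertex bundle of `W − m·K` with claim `0` checks, and
the vertex bundle of `K` with claim `κ` checks. [cite: Hladik2017, Thm. 7 ((2) ⇒ (1)), twice] -/
def checkPencilBundle (n K : ℕ) (W0 : List (List ℚ)) (Ws : List (List (List ℚ)))
    (K0 : List (List ℚ)) (Ks : List (List (List ℚ))) (lo hi : List ℚ) (b : PencilBundle) : Bool :=
  decide (0 < b.κ) &&
    checkVertexBundle n K (pencilTabs n K b.m W0 Ws K0 Ks).1 (pencilTabs n K b.m W0 Ws K0 Ks).2 lo hi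
      ⟨0, b.certsW⟩ &&
    checkVertexBundle n K K0 Ks lo hi ⟨b.κ, b.certsK⟩

/-- `finMat (A − m·B) = finMat A − m • finMat B`. [folklore] -/
private theorem finMat_subSmulTab (n : ℕ) (m : ℚ) (A B : List (List ℚ)) :
    finMat n (subSmulTab n m A B) = finMat n A - (m : ℝ) • finMat n B := by
  ext i j
  rw [Matrix.sub_apply, Matrix.smul_apply, finMat_apply', finMat_apply', finMat_apply', smul_eq_mul]
  unfold subSmulTab mreal
  rw [mget_mtab _ i.isLt j.isLt]; push_cast; ring

/-- The real family of the shifted pencil tables is `W(p) − m·K(p)`. [folklore] -/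
private theorem affine_pencilTabs_eq {n K : ℕ} (m : ℚ) (W0 : List (List ℚ))
    (Ws : List (List (List ℚ))) (K0 : List (List ℚ)) (Ks : List (List (List ℚ))) (p : Fin K → ℝ) :
    finMat n (pencilTabs n K m W0 Ws K0 Ks).1
        + paramMatrix (fun k : Fin K ↦ finMat n ((pencilTabs n K m W0 Ws K0 Ks).2.getD k [])) p
      = (finMat n W0 + paramMatrix (fun k : Fin K ↦ finMat n (Ws.getD k [])) p)
        - (m : ℝ) • (finMat n K0 + paramMatrix (fun k : Fin K ↦ finMat n (Ks.getD k [])) p) := by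
  have h2 : ∀ k : Fin K, (pencilTabs n K m W0 Ws K0 Ks).2.getD k []
      = subSmulTab n m (Ws.getD k []) (Ks.getD k []) := fun k ↦ by
    show ((List.range K).map fun k ↦ subSmulTab n m (Ws.getD k []) (Ks.getD k [])).getD k [] = _
    rw [List.getD_eq_getElem (l := (List.range K).map _) (d := []) (by simp [k.isLt]),
      List.getElem_map, List.getElem_range]
  ext i j
  simp only [Matrix.add_apply, Matrix.sub_apply, Matrix.smul_apply, paramMatrix_apply, h2,
    show (pencilTabs n K m W0 Ws K0 Ks).1 = subSmulTab n m W0 K0 from rfl, finMat_subSmulTab,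
    smul_eq_mul, mul_sub]
  rw [Finset.sum_sub_distrib, mul_add, Finset.mul_sum]
  have e : ∑ x, p x * ((m : ℝ) * finMat n (Ks.getD x []) i j)
      = ∑ x, (m : ℝ) * (p x * finMat n (Ks.getD x []) i j) :=
    Finset.sum_congr rfl fun x _ ↦ by ring
  rw [e]; ring

/-- **Pencil margin and definiteness on the whole box from a kernel-checked pencil bundle
(END-TO-END).** If `checkPencilBundle … = true` then for every `p` of the box and every `x`:
`m · xᵀK(p)x ≤ xᵀW(p)x` and `κ · xᵀx ≤ xᵀK(p)x`.
[cite: Hladik2017, Thm. 7 ((2) ⇒ (1)), margin form for `W − mK` and for `K`] -/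
theorem pencil_forms_on_box_of_checkPencilBundle {n K : ℕ} {W0 K0 : List (List ℚ)}
    {Ws Ks : List (List (List ℚ))} {lo hi : List ℚ} {b : PencilBundle}
    (h : checkPencilBundle n K W0 Ws K0 Ks lo hi b = true) {p : Fin K → ℝ}
    (hp : p ∈ Set.Icc (fun k : Fin K ↦ vreal lo k) (fun k : Fin K ↦ vreal hi k)) (x : Fin n → ℝ) :
    (b.m : ℝ) * (x ⬝ᵥ (finMat n K0 + paramMatrix (fun k : Fin K ↦ finMat n (Ks.getD k [])) p) *ᵥ x)
        ≤ x ⬝ᵥ (finMat n W0 + paramMatrix (fun k : Fin K ↦ finMat n (Ws.getD k [])) p) *ᵥ x ∧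
      (b.κ : ℝ) * (x ⬝ᵥ x)
        ≤ x ⬝ᵥ (finMat n K0 + paramMatrix (fun k : Fin K ↦ finMat n (Ks.getD k [])) p) *ᵥ x := by
  unfold checkPencilBundle at h
  simp only [Bool.and_eq_true, decide_eq_true_eq] at h
  obtain ⟨⟨-, hW⟩, hK⟩ := h
  refine ⟨?_, form_ge_on_box_of_checkVertexBundle hK hp x⟩
  have h1 := form_ge_on_box_of_checkVertexBundle hW hp x
  rw [affine_pencilTabs_eq, Matrix.sub_mulVec, dotProduct_sub, Matrix.smul_mulVec, dotProduct_smul,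
    smul_eq_mul] at h1
  push_cast at h1
  linarith

/-- **Generalised Rayleigh-quotient bound on the whole box from a pencil bundle**: `κ > 0` (checked)
makes `xᵀK(p)x > 0` for `x ≠ 0`, hence `m ≤ xᵀW(p)x / xᵀK(p)x` — every generalised eigenvalue of the
symmetric-definite pencil `(W(p), K(p))`, a stationary value of this quotient, is `≥ m` on the box.
[cite: Hladik2017, Thm. 7 ((2) ⇒ (1)), applied twice] -/
theorem le_pencil_rayleigh_of_checkPencilBundle {n K : ℕ} {W0 K0 : List (List ℚ)}
    {Ws Ks : List (List (List ℚ))} {lo hi : List ℚ} {b : PencilBundle}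
    (h : checkPencilBundle n K W0 Ws K0 Ks lo hi b = true) {p : Fin K → ℝ}
    (hp : p ∈ Set.Icc (fun k : Fin K ↦ vreal lo k) (fun k : Fin K ↦ vreal hi k)) {x : Fin n → ℝ}
    (hx : x ≠ 0) :
    0 < x ⬝ᵥ (finMat n K0 + paramMatrix (fun k : Fin K ↦ finMat n (Ks.getD k [])) p) *ᵥ x ∧
      (b.m : ℝ) ≤ (x ⬝ᵥ (finMat n W0 + paramMatrix (fun k : Fin K ↦ finMat n (Ws.getD k [])) p) *ᵥ x)
        / (x ⬝ᵥ (finMat n K0 + paramMatrix (fun k : Fin K ↦ finMat n (Ks.getD k [])) p) *ᵥ x) := by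
  obtain ⟨hWK, hKK⟩ := pencil_forms_on_box_of_checkPencilBundle h hp x
  have hκ : (0 : ℝ) < b.κ := by
    unfold checkPencilBundle at h
    simp only [Bool.and_eq_true, decide_eq_true_eq] at h
    exact_mod_cast h.1.1
  have hxx : 0 < x ⬝ᵥ x := by
    obtain ⟨i, hi⟩ := Function.ne_iff.1 hx
    exact Finset.sum_pos' (fun j _ ↦ mul_self_nonneg (x j)) ⟨i, Finset.mem_univ i, mul_self_pos.2 hi⟩
  have hKp : 0 < x ⬝ᵥ (finMat n K0 + paramMatrix (fun k : Fin K ↦ finMat n (Ks.getD k [])) p) *ᵥ x :=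
    (mul_pos hκ hxx).trans_le hKK
  exact ⟨hKp, (le_div_iff₀ hKp).2 hWK⟩

/-- Kernel example (pencil): `W(p) = [[2, p], [p, 2]]`, `K(p) = I` (constant) on `p ∈ [−1, 1]`, margin
`m = 1`, `κ = 1`: the corner tables of `W − K = [[1, ∓1], [∓1, 1]]` pass with claim `0`, those of `K = I`
with claim `1`. -/
example : checkPencilBundle 2 1 [[2, 0], [0, 2]] [[[0, 1], [1, 0]]] [[1, 0], [0, 1]] [[[0, 0], [0, 0]]]
    [-1] [1] ⟨1, 1, [⟨0, 0, [], []⟩, ⟨0, 0, [], []⟩], [⟨1, 0, [], []⟩, ⟨1, 0, [], []⟩]⟩ = true := by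
  decide +kernel

/-! ### Composition lemmas for CHUNKED kernel checking (one `decide` per corner)

Appended 2026-08-26: a single `decide +kernel` on a whole bundle is one kernel reduction, which the
farm returns only up to a certain size (measured: an `n = 31`, 4-corner pencil bundle does not return
while every corner does). The lemmas below let an emitted source prove each corner check separately and
assemble `checkVertexBundle … = true` / `checkPencilBundle … = true` by the checker's own defining
equations — no new trust, same root statement. -/

/-- The check of corner number `idx`: claim `≥ lam` and `checkLower` on the exact corner matrix.
[cite: Hladik2017, Thm. 7 (one vertex)] -/
def cornerOK (n K : ℕ) (A0 : List (List ℚ)) (As : List (List (List ℚ))) (lo hi : List ℚ)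
    (b : VertexBundle) (idx : ℕ) : Bool :=
  decide (b.lam ≤ (b.certs.getD idx default).lam) &&
    checkLower n (affineAtQ n K A0 As ((corners lo hi K).getD idx [])) (zeroTab n) (b.certs.getD idx default)

/-- **Assembling a vertex bundle from its parts**: the symmetry checks, the length check
`(corners lo hi K).length = L ≤ #certs`, and `rall L (cornerOK …)` (built corner by corner with
`KernelData.rall_succ`: `rw [rall_succ, prev, corner]; rfl`) give `checkVertexBundle … = true`. [cite: Hladik2017, Thm. 7 ((2) ⇒ (1))] -/
theorem checkVertexBundle_of_parts {n K : ℕ} {A0 : List (List ℚ)} {As : List (List (List ℚ))}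
    {lo hi : List ℚ} {b : VertexBundle} {L : ℕ} (hs : symmQ n A0 = true)
    (hss : rall K (fun k ↦ symmQ n (As.getD k [])) = true) (hL : (corners lo hi K).length = L)
    (hlen : L ≤ b.certs.length) (hall : rall L (cornerOK n K A0 As lo hi b) = true) :
    checkVertexBundle n K A0 As lo hi b = true := by
  unfold checkVertexBundle
  simp only [Bool.and_eq_true, decide_eq_true_eq]
  refine ⟨⟨⟨hs, hss⟩, hL ▸ hlen⟩, ?_⟩
  rw [hL]
  exact hall

/-- **Assembling a pencil bundle from its parts**: `κ > 0` and the two vertex-bundle checks (each of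
which may itself be assembled with `checkVertexBundle_of_parts`).
[cite: Hladik2017, Thm. 7 ((2) ⇒ (1)), twice] -/
theorem checkPencilBundle_of_parts {n K : ℕ} {W0 K0 : List (List ℚ)} {Ws Ks : List (List (List ℚ))}
    {lo hi : List ℚ} {b : PencilBundle} (hκ : 0 < b.κ)
    (hW : checkVertexBundle n K (pencilTabs n K b.m W0 Ws K0 Ks).1 (pencilTabs n K b.m W0 Ws K0 Ks).2
      lo hi ⟨0, b.certsW⟩ = true)
    (hK : checkVertexBundle n K K0 Ks lo hi ⟨b.κ, b.certsK⟩ = true) :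
    checkPencilBundle n K W0 Ws K0 Ks lo hi b = true := by
  unfold checkPencilBundle
  simp only [Bool.and_eq_true, decide_eq_true_eq]
  exact ⟨⟨hκ, hW⟩, hK⟩

/-! ### Frozen monotone coordinates (Hladík Thm 4): fewer corners, same box-level conclusion

Appended 2026-08-26: when `A^{(k)} ⪰ 0` the form `xᵀA(p)x` is non-decreasing in `p_k`, so the
coordinate may be FROZEN at `lo_k` (and at `hi_k` when `A^{(k)} ⪯ 0`) — the production vertex method
does this (`2^{K−f}` certificates). The checker `checkFrozen` verifies the positive (negative)
semidefiniteness certificates of the frozen terms; `shrinkLo` / `shrinkHi` compute the degenerate box;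
`le_eigenvalues_affine_of_checkVertexBundle_frozen` lifts a vertex bundle checked on the SHRUNKEN box to
the eigenvalue margin on the FULL box. -/

/-- Entrywise negation of a rational table. [folklore] -/
def negTab (n : ℕ) (A : List (List ℚ)) : List (List ℚ) := mtab n n fun i j ↦ -mget A i j

/-- Freeze codes per coordinate (`0` free, `1` frozen at `lo_k` — needs `A^{(k)} ⪰ 0` —, `2` frozen at
`hi_k` — needs `A^{(k)} ⪯ 0`): the lower ends of the shrunken box. [cite: Hladik2017, Thm. 4] -/
def shrinkLo (K : ℕ) (fz : List ℕ) (lo hi : List ℚ) : List ℚ :=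
  vtab K fun k ↦ if fz.getD k 0 = 2 then vget hi k else vget lo k

/-- The upper ends of the shrunken box. [cite: Hladik2017, Thm. 4] -/
def shrinkHi (K : ℕ) (fz : List ℕ) (lo hi : List ℚ) : List ℚ :=
  vtab K fun k ↦ if fz.getD k 0 = 1 then vget lo k else vget hi k

/-- **Checker of the frozen terms**: for every coordinate with code `1` a `checkLower` certificate with
claim `≥ 0` of `A^{(k)}` (positive semidefinite), with code `2` one of `−A^{(k)}`.
[cite: Hladik2017, Thm. 4 (monotonicity in `p_k` under `A^{(k)} ⪰ 0`)] -/
def checkFrozen (n K : ℕ) (As : List (List (List ℚ))) (fz : List ℕ) (certs : List LDLCert) : Bool :=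
  rall K fun k ↦
    if fz.getD k 0 = 1 then decide (0 ≤ (certs.getD k default).lam) && checkLower n (As.getD k []) (zeroTab n) (certs.getD k default)
    else if fz.getD k 0 = 2 then decide (0 ≤ (certs.getD k default).lam) && checkLower n (negTab n (As.getD k [])) (zeroTab n) (certs.getD k default)
    else true

/-- A passing `checkLower` with claim `≥ 0` and zero radii makes the table's form non-negative. [folklore] -/
private theorem form_nonneg_of_checkLower_zero {n : ℕ} {A : List (List ℚ)} {c : LDLCert}
    (h : checkLower n A (zeroTab n) c = true) (hc : 0 ≤ c.lam) (x : Fin n → ℝ) :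
    0 ≤ x ⬝ᵥ finMat n A *ᵥ x := by
  have hΔ : ∀ i j : Fin n, |finMat n A i j - mreal A i j| ≤ mreal (zeroTab n) i j := fun i j ↦ by
    rw [finMat_apply', sub_self, abs_zero]; unfold zeroTab mreal; rw [mget_mtab _ i.isLt j.isLt]; simp
  have h1 := mul_dotProduct_le_of_checkLower h hΔ x
  have hxx : 0 ≤ x ⬝ᵥ x := Finset.sum_nonneg fun i _ ↦ mul_self_nonneg (x i)
  have : (0 : ℝ) ≤ (c.lam : ℝ) * (x ⬝ᵥ x) := mul_nonneg (by exact_mod_cast hc) hxx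
  linarith

/-- `finMat (negTab A) = −finMat A`. [folklore] -/
private theorem finMat_negTab (n : ℕ) (A : List (List ℚ)) : finMat n (negTab n A) = -finMat n A := by
  ext i j
  rw [Matrix.neg_apply, finMat_apply', finMat_apply']; unfold negTab mreal
  rw [mget_mtab _ i.isLt j.isLt]; push_cast; rfl

/-- **Monotone lift (Hladík Thm 4).** If the frozen terms check, then for every `p` of the FULL box the
form at `p` dominates the form at the point `p'` of the SHRUNKEN box obtained by moving the code-`1`
coordinates to `lo_k` and the code-`2` coordinates to `hi_k`.
[cite: Hladik2017, Thm. 4 ((1) ⇔ (2): PSD terms are monotone)] -/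
theorem form_ge_frozen_point_of_checkFrozen {n K : ℕ} {A0 : List (List ℚ)} {As : List (List (List ℚ))}
    {fz : List ℕ} {certs : List LDLCert} (h : checkFrozen n K As fz certs = true) {lo hi : List ℚ}
    {p : Fin K → ℝ} (hp : p ∈ Set.Icc (fun k : Fin K ↦ vreal lo k) (fun k : Fin K ↦ vreal hi k))
    (x : Fin n → ℝ) :
    x ⬝ᵥ (finMat n A0 + paramMatrix (fun k : Fin K ↦ finMat n (As.getD k []))
        (fun k : Fin K ↦ if fz.getD k 0 = 1 then vreal lo k else if fz.getD k 0 = 2 then vreal hi k else p k)) *ᵥ x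
      ≤ x ⬝ᵥ (finMat n A0 + paramMatrix (fun k : Fin K ↦ finMat n (As.getD k [])) p) *ᵥ x := by
  rw [Matrix.add_mulVec, dotProduct_add, Matrix.add_mulVec, dotProduct_add, form_paramMatrix, form_paramMatrix]
  refine add_le_add le_rfl (Finset.sum_le_sum fun k _ ↦ ?_)
  have hk := of_rall h k.isLt
  by_cases h1 : fz.getD k 0 = 1
  · rw [if_pos h1] at hk ⊢
    rw [Bool.and_eq_true, decide_eq_true_eq] at hk
    have hf := form_nonneg_of_checkLower_zero hk.2 hk.1 x
    exact mul_le_mul_of_nonneg_right (hp.1 k) hf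
  · rw [if_neg h1] at hk ⊢
    by_cases h2 : fz.getD k 0 = 2
    · rw [if_pos h2] at hk ⊢
      rw [Bool.and_eq_true, decide_eq_true_eq] at hk
      have hf := form_nonneg_of_checkLower_zero hk.2 hk.1 x
      rw [finMat_negTab, Matrix.neg_mulVec, dotProduct_neg] at hf
      -- the form of A^{(k)} is ≤ 0 and p k ≤ hi k
      nlinarith [hp.2 k]
    · rw [if_neg h2]

/-- The frozen point lies in the shrunken box. [folklore] -/
private theorem frozen_point_mem_shrunk {K : ℕ} {fz : List ℕ} {lo hi : List ℚ} {p : Fin K → ℝ}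
    (hp : p ∈ Set.Icc (fun k : Fin K ↦ vreal lo k) (fun k : Fin K ↦ vreal hi k)) :
    (fun k : Fin K ↦ if fz.getD k 0 = 1 then vreal lo k else if fz.getD k 0 = 2 then vreal hi k else p k)
      ∈ Set.Icc (fun k : Fin K ↦ vreal (shrinkLo K fz lo hi) k) (fun k : Fin K ↦ vreal (shrinkHi K fz lo hi) k) := by
  have eLo : ∀ k : Fin K, vreal (shrinkLo K fz lo hi) k = if fz.getD k 0 = 2 then vreal hi k else vreal lo k := by
    intro k; unfold vreal shrinkLo; rw [vget_vtab _ k.isLt]; split_ifs <;> rfl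
  have eHi : ∀ k : Fin K, vreal (shrinkHi K fz lo hi) k = if fz.getD k 0 = 1 then vreal lo k else vreal hi k := by
    intro k; unfold vreal shrinkHi; rw [vget_vtab _ k.isLt]; split_ifs <;> rfl
  refine ⟨fun k ↦ ?_, fun k ↦ ?_⟩
  · dsimp only
    rw [eLo]
    by_cases h1 : fz.getD k 0 = 1
    · have h2 : fz.getD k 0 ≠ 2 := by omega
      rw [if_neg h2, if_pos h1]
    · rw [if_neg h1]
      by_cases h2 : fz.getD k 0 = 2
      · rw [if_pos h2, if_pos h2]
      · rw [if_neg h2, if_neg h2]; exact hp.1 k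
  · dsimp only
    rw [eHi]
    by_cases h1 : fz.getD k 0 = 1
    · rw [if_pos h1, if_pos h1]
    · rw [if_neg h1, if_neg h1]
      by_cases h2 : fz.getD k 0 = 2
      · rw [if_pos h2]
      · rw [if_neg h2]; exact hp.2 k

/-- **Eigenvalue margin on the FULL box from a vertex bundle on the SHRUNKEN box plus the frozen-term
certificates (Hladík Thm 7 + Thm 4, end-to-end).** [cite: Hladik2017, Thm. 4 and Thm. 7] -/
theorem le_eigenvalues_affine_of_checkVertexBundle_frozen {n K : ℕ} {A0 : List (List ℚ)}
    {As : List (List (List ℚ))} {lo hi : List ℚ} {fz : List ℕ} {certs : List LDLCert}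
    {b : VertexBundle} (hf : checkFrozen n K As fz certs = true)
    (h : checkVertexBundle n K A0 As (shrinkLo K fz lo hi) (shrinkHi K fz lo hi) b = true)
    {p : Fin K → ℝ} (hp : p ∈ Set.Icc (fun k : Fin K ↦ vreal lo k) (fun k : Fin K ↦ vreal hi k))
    (i : Fin n) :
    (b.lam : ℝ) ≤ (isHermitian_affine (isHermitian_A0_of_checkVertexBundle h)
      (isHermitian_As_of_checkVertexBundle h) p).eigenvalues i :=
  le_eigenvalues_of_forall_form_real _ (fun x ↦
    (form_ge_on_box_of_checkVertexBundle h (frozen_point_mem_shrunk hp) x).trans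
      (form_ge_frozen_point_of_checkFrozen hf hp x)) i


end Literature.Analysis.ValidatedNumerics
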